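import Mathlib
import HarnessLib
import Literature.Analysis.FluidPDE.VectorCalculus
import Literature.Analysis.FluidPDE.LerayGaugeStrainSpectrum

/-!
# Stub `stub_dissipationPosOfFarField` of the line `Sketch`
# (crux stmt-AnomalousDissipation-19034, `PointSink.ConeDesingularisation`)

POSITIVITY OF THE DISSIPATION IS AUTOMATIC. If a `C¹` field `Q : ℝ³ → ℝ³` with `∫ |∇Q|² < ∞` is
shell-`L²`-asymptotic at rate `o(λ^{5k/3})` to a field `V` that is discretely self-similar of degree
`-2/3` (`V (λ x) = λ^{-2/3} V x` off the origin) and non-trivial on the fundamental shell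
`1 < |x| < λ`, then `0 < ∫ |∇Q|²`.

Proof. The integral is `≥ 0`; suppose it vanishes. The integrand `|∇Q(x)|²` is continuous,
nonnegative and integrable with integral `0`, so it vanishes a.e., hence everywhere (Lebesgue measure
charges open sets), so `∇Q ≡ 0` and `Q ≡ a` is constant (`coneDissip_exists_const`). Iterating the
DSS law (`coneDissip_dss_pow`) and changing variables `x = λ^k y` on the shells
(`λ^k • shell₀ = shell_k`, `coneDissip_smul_shell`) turns the normalised shell error into
`e_k = (λ^k)^{4/3} ∫_{shell₀} ‖a - (λ^k)^{-2/3} V‖²` (`coneDissip_shell_error_eq`). With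
`m := ∫_{shell₀} ‖V‖² > 0`, `v := vol (shell₀) > 0`, `w_k := (λ^k)^{4/3} → ∞`, `c_k := (λ^k)^{-2/3}`
(`w_k c_k² = 1`): if `a = 0` then `e_k = m` for all `k`, contradicting `e_k → 0`; if `a ≠ 0` then
`v ‖a‖² ≤ 2 ∫_{shell₀} ‖a - c_k V‖² + 2 c_k² m` (pointwise `‖a‖² ≤ 2‖a - c_k V‖² + 2‖c_k V‖²`),
i.e. `w_k v ‖a‖² ≤ 2 e_k + 2 m`, whose left side tends to `∞` and right side to `2m`
(`coneDissip_real_contradiction`).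

References: elementary real analysis (change of variables for Lebesgue measure under dilations,
Mathlib `MeasureTheory.Measure.setIntegral_comp_smul_of_pos`; constancy from vanishing derivative,
Mathlib `is_const_of_fderiv_eq_zero`). The skeleton: `Lines/Sketch.lean` of the crux
(`ConeDesingularisation_of`, stub 5).
-/

noncomputable section

-- `Summit.<Summit>.<Problem>`: single-conjunct summit, the duplicate namespace is mandated (CONVENTIONS §2).
set_option linter.dupNamespace false

namespace Summit.AnomalousDissipation.AnomalousDissipation.Theorems

open MeasureTheory Filter Topology Set
open Literature.Analysis.FluidPDE
open scoped Pointwise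

/-- Points / velocity values of `ℝ³`. -/
local notation "E³" => EuclideanSpace ℝ (Fin 3)

/-! ## Step (a): zero dissipation forces a constant field -/

/-- A `C¹` field `Q : ℝ³ → ℝ³` whose dissipation density `|∇Q|²` is integrable with integral `0`
is constant: the continuous nonnegative integrand vanishes a.e., hence everywhere, so `∇Q ≡ 0`.
[folklore] -/
theorem coneDissip_exists_const {Q : E³ → E³} (hQ : ContDiff ℝ 1 Q)
    (hInt : Integrable (fun x => frobeniusNormSq (fderiv ℝ Q x)))
    (h0 : ∫ x, frobeniusNormSq (fderiv ℝ Q x) = 0) : ∃ a : E³, ∀ x, Q x = a := by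
  have hcont : Continuous (fderiv ℝ Q) := hQ.continuous_fderiv one_ne_zero
  have hcont' : Continuous fun x => frobeniusNormSq (fderiv ℝ Q x) := by
    unfold frobeniusNormSq
    exact continuous_finsetSum _ fun i _ => (hcont.clm_apply continuous_const).norm.pow 2
  have hae : (fun x => frobeniusNormSq (fderiv ℝ Q x)) =ᵐ[volume] 0 :=
    (integral_eq_zero_iff_of_nonneg (fun x => frobeniusNormSq_nonneg _) hInt).1 h0
  have hall : (fun x => frobeniusNormSq (fderiv ℝ Q x)) = 0 :=
    (hcont'.ae_eq_iff_eq volume continuous_zero).1 hae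
  have hD : ∀ x, fderiv ℝ Q x = 0 := fun x =>
    (frobeniusNormSq_eq_zero_iff _).1 (congr_fun hall x)
  exact ⟨Q 0, fun x => is_const_of_fderiv_eq_zero (hQ.differentiable one_ne_zero) hD x 0⟩

/-! ## Step (b): discrete self-similarity on the shells -/

/-- Iterated DSS law: `V (λ^k • x) = (λ^k)^{-2/3} • V x` for `x ≠ 0`. [folklore] -/
theorem coneDissip_dss_pow {lam : ℝ} {V : E³ → E³} (hlam : 0 < lam)
    (hVss : ∀ x : E³, x ≠ 0 → V (lam • x) = lam ^ (-(2 / 3 : ℝ)) • V x) (k : ℕ) :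
    ∀ x : E³, x ≠ 0 → V (lam ^ k • x) = (lam ^ k) ^ (-(2 / 3 : ℝ)) • V x := by
  induction k with
  | zero => intro _ _; simp
  | succ k ih =>
    intro x hx
    rw [pow_succ', mul_smul, hVss _ (smul_ne_zero (pow_pos hlam k).ne' hx), ih x hx, smul_smul,
      Real.mul_rpow hlam.le (pow_pos hlam k).le]

/-- The dilate of the fundamental shell is the `k`-th shell:
`λ^k • {1 < |x| < λ} = {λ^k < |x| < λ^{k+1}}`. [folklore] -/
theorem coneDissip_smul_shell {lam : ℝ} (hlam : 0 < lam) (k : ℕ) :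
    lam ^ k • {x : E³ | 1 < ‖x‖ ∧ ‖x‖ < lam} =
      {x : E³ | lam ^ k < ‖x‖ ∧ ‖x‖ < lam ^ (k + 1)} := by
  have hR : 0 < lam ^ k := pow_pos hlam k
  ext x
  rw [Set.mem_smul_set_iff_inv_smul_mem₀ hR.ne']
  simp only [Set.mem_setOf_eq, norm_smul, norm_inv, Real.norm_eq_abs, abs_of_pos hR]
  rw [inv_mul_eq_div, one_lt_div hR, div_lt_iff₀' hR, pow_succ]

/-- The fundamental shell `{1 < |x| < λ}` is open. [folklore] -/
theorem coneDissip_isOpen_shell (lam : ℝ) : IsOpen {x : E³ | 1 < ‖x‖ ∧ ‖x‖ < lam} :=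
  (isOpen_lt continuous_const continuous_norm).and (isOpen_lt continuous_norm continuous_const)

/-- The fundamental shell has finite volume. [folklore] -/
theorem coneDissip_volume_shell_lt_top (lam : ℝ) :
    volume {x : E³ | 1 < ‖x‖ ∧ ‖x‖ < lam} < ⊤ :=
  (measure_mono fun _ hx => mem_ball_zero_iff.2 hx.2).trans_lt measure_ball_lt_top

/-- The fundamental shell has positive (real) volume when `1 < λ`: it is open and contains the
point `((1 + λ)/2) e₀`. [folklore] -/
theorem coneDissip_volumeReal_shell_pos {lam : ℝ} (hlam : 1 < lam) :
    0 < volume.real {x : E³ | 1 < ‖x‖ ∧ ‖x‖ < lam} := by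
  have h : ‖((1 + lam) / 2 : ℝ) • EuclideanSpace.single (0 : Fin 3) (1 : ℝ)‖ = (1 + lam) / 2 := by
    rw [norm_smul, Real.norm_eq_abs, abs_of_pos (by linarith)]
    simp
  refine ENNReal.toReal_pos ((coneDissip_isOpen_shell lam).measure_pos volume
    ⟨((1 + lam) / 2 : ℝ) • EuclideanSpace.single (0 : Fin 3) (1 : ℝ), ?_⟩).ne'
    (coneDissip_volume_shell_lt_top lam).ne
  simp only [Set.mem_setOf_eq, h]
  constructor <;> linarith

/-- `‖V‖²` is integrable on the fundamental shell, a relatively compact subset of `ℝ³ ∖ {0}` on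
which `‖V‖²` is locally integrable. [folklore] -/
theorem coneDissip_integrableOn_shell {lam : ℝ} {V : E³ → E³}
    (hVloc : LocallyIntegrableOn (fun x => ‖V x‖ ^ 2) {x : E³ | x ≠ 0} volume) :
    IntegrableOn (fun x => ‖V x‖ ^ 2) {x : E³ | 1 < ‖x‖ ∧ ‖x‖ < lam} volume := by
  have hK : IsCompact {x : E³ | 1 ≤ ‖x‖ ∧ ‖x‖ ≤ lam} :=
    (isCompact_closedBall (0 : E³) lam).of_isClosed_subset
      ((isClosed_le continuous_const continuous_norm).inter
        (isClosed_le continuous_norm continuous_const))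
      fun x hx => mem_closedBall_zero_iff.2 hx.2
  have hsub : {x : E³ | 1 ≤ ‖x‖ ∧ ‖x‖ ≤ lam} ⊆ {x : E³ | x ≠ 0} := by
    rintro x hx rfl
    norm_num at hx
  exact (hVloc.integrableOn_compact_subset hsub hK).mono_set fun x hx => ⟨hx.1.le, hx.2.le⟩

/-- Exponent bookkeeping: `R^{-5/3} R³ = R^{4/3}` for `R > 0`. [folklore] -/
theorem coneDissip_rpow_aux1 {R : ℝ} (hR : 0 < R) :
    R ^ (-(5 / 3 : ℝ)) * R ^ 3 = R ^ (4 / 3 : ℝ) := by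
  rw [← Real.rpow_natCast R 3, ← Real.rpow_add hR]
  norm_num

/-- Exponent bookkeeping: `R^{4/3} (R^{-2/3})² = 1` for `R > 0`. [folklore] -/
theorem coneDissip_rpow_aux2 {R : ℝ} (hR : 0 < R) :
    R ^ (4 / 3 : ℝ) * (R ^ (-(2 / 3 : ℝ))) ^ 2 = 1 := by
  rw [sq, ← Real.rpow_add hR, ← Real.rpow_add hR]
  norm_num

/-- `(λ^k)^{4/3} → ∞` for `λ > 1`. [folklore] -/
theorem coneDissip_tendsto_rpow {lam : ℝ} (hlam : 1 < lam) :
    Tendsto (fun k : ℕ => (lam ^ k) ^ (4 / 3 : ℝ)) atTop atTop := by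
  have h := tendsto_pow_atTop_atTop_of_one_lt (Real.one_lt_rpow hlam (by norm_num : (0 : ℝ) < 4 / 3))
  refine h.congr fun k => ?_
  exact Real.rpow_pow_comm (zero_le_one.trans hlam.le) _ _

/-- **Shell error on the fundamental shell.** For a constant `a` and a DSS field `V`, the normalised
`k`-th shell error is `(λ^k)^{-5/3} ∫_{shell_k} ‖a - V‖² = (λ^k)^{4/3} ∫_{shell₀} ‖a - (λ^k)^{-2/3} V‖²`
(change of variables `x = λ^k y`, `vol` scales by `λ^{3k}`, and the iterated DSS law). [folklore] -/
theorem coneDissip_shell_error_eq {lam : ℝ} {V : E³ → E³} (hlam : 0 < lam)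
    (hVss : ∀ x : E³, x ≠ 0 → V (lam • x) = lam ^ (-(2 / 3 : ℝ)) • V x) (a : E³) (k : ℕ) :
    (lam ^ k) ^ (-(5 / 3 : ℝ)) *
        ∫ x in {x : E³ | lam ^ k < ‖x‖ ∧ ‖x‖ < lam ^ (k + 1)}, ‖a - V x‖ ^ 2 =
      (lam ^ k) ^ (4 / 3 : ℝ) *
        ∫ y in {x : E³ | 1 < ‖x‖ ∧ ‖x‖ < lam}, ‖a - (lam ^ k) ^ (-(2 / 3 : ℝ)) • V y‖ ^ 2 := by
  have hR : 0 < lam ^ k := pow_pos hlam k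
  have h := Measure.setIntegral_comp_smul_of_pos volume (fun x => ‖a - V x‖ ^ 2)
    {x : E³ | 1 < ‖x‖ ∧ ‖x‖ < lam} hR
  rw [coneDissip_smul_shell hlam k, finrank_euclideanSpace_fin, smul_eq_mul,
    eq_inv_mul_iff_mul_eq₀ (pow_ne_zero 3 hR.ne')] at h
  have hcongr : ∫ x in {x : E³ | 1 < ‖x‖ ∧ ‖x‖ < lam}, ‖a - V (lam ^ k • x)‖ ^ 2 =
      ∫ x in {x : E³ | 1 < ‖x‖ ∧ ‖x‖ < lam}, ‖a - (lam ^ k) ^ (-(2 / 3 : ℝ)) • V x‖ ^ 2 :=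
    setIntegral_congr_fun (coneDissip_isOpen_shell lam).measurableSet fun x hx => by
      show ‖a - V (lam ^ k • x)‖ ^ 2 = ‖a - (lam ^ k) ^ (-(2 / 3 : ℝ)) • V x‖ ^ 2
      rw [coneDissip_dss_pow hlam hVss k x (norm_pos_iff.1 (one_pos.trans hx.1))]
  rw [← h, ← mul_assoc, coneDissip_rpow_aux1 hR, hcongr]

/-! ## Step (c): the `L²(shell₀)` bookkeeping and the real-variable contradiction -/

/-- `‖a - c V‖²` is integrable on a finite-volume set on which `‖V‖²` is integrable
(`‖a - c V‖² ≤ 2‖a‖² + 2c²‖V‖²`). [folklore] -/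
theorem coneDissip_integrableOn_sub_smul {V : E³ → E³} {S : Set E³}
    (hV : AEStronglyMeasurable V volume) (hS : volume S < ⊤)
    (hVS : IntegrableOn (fun x => ‖V x‖ ^ 2) S volume) (a : E³) (c : ℝ) :
    IntegrableOn (fun x => ‖a - c • V x‖ ^ 2) S volume := by
  have hg : IntegrableOn (fun x => 2 * ‖a‖ ^ 2 + 2 * (c ^ 2 * ‖V x‖ ^ 2)) S volume :=
    (integrableOn_const hS.ne).add ((hVS.const_mul _).const_mul _)
  refine Integrable.mono' hg
    ((aestronglyMeasurable_const.sub (hV.const_smul c)).norm.pow 2).restrict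
    (Eventually.of_forall fun x => ?_)
  rw [Real.norm_of_nonneg (sq_nonneg _)]
  have h1 : ‖a - c • V x‖ ≤ ‖a‖ + ‖c • V x‖ := norm_sub_le a (c • V x)
  have h2 : ‖c • V x‖ ^ 2 = c ^ 2 * ‖V x‖ ^ 2 := by
    rw [norm_smul, mul_pow, Real.norm_eq_abs, sq_abs]
  have h3 : ‖a - c • V x‖ ^ 2 ≤ (‖a‖ + ‖c • V x‖) ^ 2 :=
    pow_le_pow_left₀ (norm_nonneg _) h1 2
  nlinarith [sq_nonneg (‖a‖ - ‖c • V x‖)]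

/-- The `L²(S)` triangle inequality against a constant: `vol(S) ‖a‖² ≤ 2 ∫_S ‖a - c V‖² + 2 c² ∫_S ‖V‖²`.
[folklore] -/
theorem coneDissip_const_sq_le {V : E³ → E³} {S : Set E³}
    (hV : AEStronglyMeasurable V volume) (hS : volume S < ⊤)
    (hVS : IntegrableOn (fun x => ‖V x‖ ^ 2) S volume) (a : E³) (c : ℝ) :
    volume.real S * ‖a‖ ^ 2 ≤
      (2 * ∫ x in S, ‖a - c • V x‖ ^ 2) + 2 * (c ^ 2 * ∫ x in S, ‖V x‖ ^ 2) := by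
  have hpt : ∀ x, ‖a‖ ^ 2 ≤ 2 * ‖a - c • V x‖ ^ 2 + 2 * (c ^ 2 * ‖V x‖ ^ 2) := fun x => by
    have h1 : ‖a‖ ≤ ‖a - c • V x‖ + ‖c • V x‖ := by
      have := norm_sub_norm_le a (c • V x)
      linarith
    have h2 : ‖c • V x‖ ^ 2 = c ^ 2 * ‖V x‖ ^ 2 := by
      rw [norm_smul, mul_pow, Real.norm_eq_abs, sq_abs]
    have h3 : ‖a‖ ^ 2 ≤ (‖a - c • V x‖ + ‖c • V x‖) ^ 2 :=
      pow_le_pow_left₀ (norm_nonneg _) h1 2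
    nlinarith [sq_nonneg (‖a - c • V x‖ - ‖c • V x‖)]
  have hAI : IntegrableOn (fun x => 2 * ‖a - c • V x‖ ^ 2) S volume :=
    (coneDissip_integrableOn_sub_smul hV hS hVS a c).const_mul 2
  have hVI : IntegrableOn (fun x => 2 * (c ^ 2 * ‖V x‖ ^ 2)) S volume :=
    (hVS.const_mul _).const_mul 2
  have hI : ∫ x in S, ‖a‖ ^ 2 ≤ ∫ x in S, (2 * ‖a - c • V x‖ ^ 2 + 2 * (c ^ 2 * ‖V x‖ ^ 2)) :=
    integral_mono (integrableOn_const hS.ne) (hAI.add hVI) hpt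
  rw [setIntegral_const, smul_eq_mul, integral_add hAI hVI, integral_const_mul, integral_const_mul,
    integral_const_mul] at hI
  exact hI

/-- **The real-variable contradiction.** With `v, m > 0`, `n ≥ 0`, weights `w_k > 0`, `w_k → ∞`,
`w_k c_k² = 1`, errors `w_k I_k → 0`, the identity `I_k = c_k² m` when `n = 0` and the bound
`v n ≤ 2 I_k + 2 c_k² m` are incompatible: `n = 0` gives the constant error `m`, `n > 0` gives
`w_k v n ≤ 2 w_k I_k + 2 m` with unbounded left side. [folklore] -/
theorem coneDissip_real_contradiction {v m n : ℝ} {w I c : ℕ → ℝ} (hv : 0 < v) (hm : 0 < m)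
    (hn : 0 ≤ n) (hwpos : ∀ k, 0 < w k) (hwc : ∀ k, w k * c k ^ 2 = 1)
    (hw : Tendsto w atTop atTop) (hTend : Tendsto (fun k => w k * I k) atTop (𝓝 0))
    (hzero : n = 0 → ∀ k, I k = c k ^ 2 * m)
    (hbound : ∀ k, v * n ≤ 2 * I k + 2 * (c k ^ 2 * m)) : False := by
  rcases hn.eq_or_lt with hn0 | hn0
  · have hI : ∀ k, w k * I k = m := fun k => by
      rw [hzero hn0.symm k, ← mul_assoc, hwc, one_mul]
    simp_rw [hI] at hTend
    exact hm.ne (tendsto_nhds_unique hTend tendsto_const_nhds)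
  · have hkey : ∀ k, w k * (v * n) ≤ 2 * (w k * I k) + 2 * m := fun k => by
      calc w k * (v * n) ≤ w k * (2 * I k + 2 * (c k ^ 2 * m)) :=
            mul_le_mul_of_nonneg_left (hbound k) (hwpos k).le
        _ = 2 * (w k * I k) + 2 * (w k * c k ^ 2) * m := by ring
        _ = 2 * (w k * I k) + 2 * m := by rw [hwc, mul_one]
    have h1 := (hw.atTop_mul_const (mul_pos hv hn0)).eventually_gt_atTop (2 * 1 + 2 * m)
    have h2 := (tendsto_order.1 hTend).2 1 one_pos
    obtain ⟨k, hk1, hk2⟩ := (h1.and h2).exists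
    have := hkey k
    linarith

/-! ## The stub -/

/-- **Stub 5 — `stub_dissipationPosOfFarField`.** POSITIVITY OF THE DISSIPATION IS AUTOMATIC: if a
`C¹` field `Q` with `∫|∇Q|² < ∞` is shell-`L²`-asymptotic at rate `o(λ^{5k/3})` to a DSS field `V`
of degree `−2/3` that is non-trivial on the fundamental shell, then `0 < ∫ |∇Q|²`. Proof:
otherwise `|∇Q|² = 0` a.e., hence everywhere (continuity), so `Q ≡ a`; if `a = 0` the normalised
shell error is the constant `∫_{shell 0}|V|² > 0`; if `a ≠ 0` it dominates
`½ vol(shell 0) |a|² λ^{4k/3} − ∫_{shell 0}|V|² → ∞`; either way it does not tend to `0`. [folklore] -/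
theorem stub_dissipationPosOfFarField :
    ∀ (lam : ℝ) (V Q : E³ → E³), 1 < lam → ContDiff ℝ 1 Q → AEStronglyMeasurable V volume →
      (∀ x : E³, x ≠ 0 → V (lam • x) = lam ^ (-(2 / 3 : ℝ)) • V x) →
      LocallyIntegrableOn (fun x => ‖V x‖ ^ 2) {x : E³ | x ≠ 0} volume →
      0 < ∫ x in {x : E³ | 1 < ‖x‖ ∧ ‖x‖ < lam}, ‖V x‖ ^ 2 →
      Integrable (fun x => frobeniusNormSq (fderiv ℝ Q x)) →
      Tendsto (fun k : ℕ => (lam ^ k) ^ (-(5 / 3 : ℝ)) *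
          ∫ x in {x : E³ | lam ^ k < ‖x‖ ∧ ‖x‖ < lam ^ (k + 1)}, ‖Q x - V x‖ ^ 2) atTop (𝓝 0) →
      0 < ∫ x, frobeniusNormSq (fderiv ℝ Q x) := by
  intro lam V Q hlam hQ hV hVss hVloc hm hInt hTend
  refine (integral_nonneg fun x => frobeniusNormSq_nonneg _).lt_of_ne' fun hzero => ?_
  -- (a) `Q` is a constant `a`
  obtain ⟨a, ha⟩ := coneDissip_exists_const hQ hInt hzero
  have hlam0 : 0 < lam := one_pos.trans hlam
  have hSfin := coneDissip_volume_shell_lt_top lam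
  have hv := coneDissip_volumeReal_shell_pos hlam
  have hVS := coneDissip_integrableOn_shell (lam := lam) hVloc
  -- (b) the normalised shell errors, transported to the fundamental shell
  have hT : Tendsto (fun k : ℕ => (lam ^ k) ^ (4 / 3 : ℝ) *
      ∫ y in {x : E³ | 1 < ‖x‖ ∧ ‖x‖ < lam}, ‖a - (lam ^ k) ^ (-(2 / 3 : ℝ)) • V y‖ ^ 2)
      atTop (𝓝 0) := by
    refine hTend.congr fun k => ?_
    simp only [ha]
    exact coneDissip_shell_error_eq hlam0 hVss a k
  -- (c) the real-variable contradiction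
  refine coneDissip_real_contradiction (w := fun k : ℕ => (lam ^ k) ^ (4 / 3 : ℝ))
    (c := fun k : ℕ => (lam ^ k) ^ (-(2 / 3 : ℝ)))
    (I := fun k : ℕ =>
      ∫ y in {x : E³ | 1 < ‖x‖ ∧ ‖x‖ < lam}, ‖a - (lam ^ k) ^ (-(2 / 3 : ℝ)) • V y‖ ^ 2)
    hv hm (sq_nonneg ‖a‖) (fun k => Real.rpow_pos_of_pos (pow_pos hlam0 k) _)
    (fun k => coneDissip_rpow_aux2 (pow_pos hlam0 k)) (coneDissip_tendsto_rpow hlam) hT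
    (fun hn k => ?_) (fun k => coneDissip_const_sq_le hV hSfin hVS a _)
  -- the case `a = 0`: the transported error is `c_k² m`
  have ha0 : a = 0 := norm_eq_zero.1 ((pow_eq_zero_iff two_ne_zero).1 hn)
  have h2 : ∀ y, ‖a - (lam ^ k) ^ (-(2 / 3 : ℝ)) • V y‖ ^ 2 =
      ((lam ^ k) ^ (-(2 / 3 : ℝ))) ^ 2 * ‖V y‖ ^ 2 := fun y => by
    rw [ha0, zero_sub, norm_neg, norm_smul, mul_pow, Real.norm_eq_abs, sq_abs]
  show ∫ y in {x : E³ | 1 < ‖x‖ ∧ ‖x‖ < lam}, ‖a - (lam ^ k) ^ (-(2 / 3 : ℝ)) • V y‖ ^ 2 = _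
  simp_rw [h2]
  exact integral_const_mul _ _

end Summit.AnomalousDissipation.AnomalousDissipation.Theorems

end
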